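import Literature.AlgebraicGeometry.Frobenioids.PadicKummerSetting
import Literature.AlgebraicGeometry.Frobenioids.KummerConjugation
import HarnessLib

/-!
# Frobenioids II, §2: the `G_A/H_A`-actions — discharge of the conjugation invariance, the
action clause of Theorem 2.4 (i), Remark 2.4.1

Mochizuki, *The geometry of Frobenioids II*, Kyushu J. Math. **62** (2008) 401–460, §2, Definition
2.2 (i)–(ii) p. 17, Theorem 2.4 (i) pp. 19–20, Remark 2.4.1 p. 22
[cite: MochizukiFrdII2008, Thm 2.4 (i) p.20]. Companion to `PadicKummerSetting.lean`
(abc-iut-L1-t7), additive: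

* `saturationConjugationInvariant_holds` — DISCHARGE of the named fact
  `PadicKummer.SaturationConjugationInvariant` ("[conditions which are unaffected by composition with
  conjugation by an element of `G`]", Def. 2.2 (ii) p. 17): `H_A` is carried to `H.map(γ·outer·γ⁻¹)`
  by conjugation with `γ = outer g`, and `Kummer.isCohSaturated_iff_of_conj` transports (c).
* The natural actions of `G` (through `G ↠ G_A`, i.e. of `(G)_A/(H)_A`) on `O^□(A)` (`actE ∘ outer`),
  on `H_A` (conjugation by `outer g`), on `H¹(H_A, μ_N(A))` (`Def22Context.h1ActG`) and on `F_N(A)`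
  (`Def22Context.fnActG`, via the kernel stability `Kummer.cohAct_mem_fnKer` along the conjugation
  `conjH g` of `H`) — and the clause of **Theorem 2.4 (i)** omitted in `PadicKummerSetting.Thm24i`:
  "[compatible] with the various natural actions of `(G₁)_{A₁}/(H₁)_{A₁}`, `(G₂)_{A₂}/(H₂)_{A₂}`"
  (`Thm24iActionCompat`, SCHEMA over `Thm24Data`; the closed instantiation lives with abc-iut-L1-t4's
  `p`-adic Frobenioid Ex. 1.1 v3 and abc-iut-L4-t4's LCFT pin).
* **Remark 2.4.1** (`Rmk241Indeterminacy`, SCHEMA): the comparison data at two levels `N`, `N'`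
  agree up to a `(G₂)_{A₂}/(H₂)_{A₂}`-indeterminacy — the finite-level content of "one obtains a
  profinite version of Theorem 2.4, (i), so long as one allows for a `(Gᵢ)_{Aᵢ}/(Hᵢ)_{Aᵢ}`-
  indeterminacy"; the profinite LIMIT over `N` (with varying `Aᵢ`, p. 22) is not constructed here
  (named deferral).
-/

namespace Literature.AlgebraicGeometry.Frobenioids

namespace PadicKummer

open Kummer

namespace Def22Context

variable (X : Def22Context)

/-- `outer g` normalises `H_A` (`H ⊴ G`). [cite: MochizukiFrdII2008, Def 2.2 (i) p.17] -/
theorem outer_conj_mem_HA (g : X.G) : ∀ k ∈ X.HA, X.outer g * k * (X.outer g)⁻¹ ∈ X.HA := by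
  rintro _ ⟨h, hh, rfl⟩
  exact ⟨g * h * g⁻¹, X.normalH.conj_mem h hh g, by simp [map_mul, map_inv]⟩

/-- `(outer g)⁻¹` normalises `H_A`. [cite: MochizukiFrdII2008, Def 2.2 (i) p.17] -/
theorem outer_inv_conj_mem_HA (g : X.G) : ∀ k ∈ X.HA, (X.outer g)⁻¹ * k * X.outer g ∈ X.HA := by
  intro k hk
  simpa [map_inv] using X.outer_conj_mem_HA g⁻¹ k hk

/-- Conjugation by `g ∈ G` on the open normal subgroup `H`, as an isomorphism of topological
groups (Mathlib `MulAut.conjNormal` made continuous). [cite: MochizukiFrdII2008, Def 2.2 (i) p.17] -/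
def conjH (g : X.G) : X.H ≃ₜ* X.H :=
  { (MulAut.conjNormal g : X.H ≃* X.H) with
    continuous_toFun := by
      refine Continuous.subtype_mk ?_ _
      exact (continuous_const.mul continuous_subtype_val).mul continuous_const
    continuous_invFun := by
      refine Continuous.subtype_mk ?_ _
      exact (continuous_const.mul continuous_subtype_val).mul continuous_const }

/-- `conjH g h = g h g⁻¹`. [cite: MochizukiFrdII2008, Def 2.2 (i) p.17] -/
theorem coe_conjH (g : X.G) (h : X.H) : ((X.conjH g h : X.H) : X.G) = g * h * g⁻¹ :=
  MulAut.conjNormal_apply g h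

/-- `q(g h g⁻¹) = outer(g) q(h) outer(g)⁻¹` for `q = H ↠ H_A`. [cite: MochizukiFrdII2008, Def 2.2 (i) p.17] -/
theorem qHA_conjH (g : X.G) (h : X.H) :
    ((X.qHA (X.conjH g h) : X.HA) : X.AutE) = X.outer g * X.qHA h * (X.outer g)⁻¹ := by
  show X.outer ((X.conjH g h : X.H) : X.G) = X.outer g * X.outer h * (X.outer g)⁻¹
  rw [coe_conjH, map_mul, map_mul, map_inv]

/-- The natural action of `g ∈ G` (through `G ↠ G_A`) on `H¹(H_A, μ_N(A))` (Mathlib group cohomology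
of the discrete `H_A`, where the Kummer classes live). [cite: MochizukiFrdII2008, Thm 2.4 (i) p.20] -/
noncomputable def h1ActG (N : ℕ) (g : X.G) :=
  Kummer.h1Act N X.O X.HA (X.outer g) (X.outer_conj_mem_HA g)

/-- The natural action of `g ∈ G` (through `G ↠ G_A`) on `F_N(A)`.
[cite: MochizukiFrdII2008, Thm 2.4 (i) p.20] -/
noncomputable def fnActG (N : ℕ) (g : X.G) : FN X N →+ FN X N :=
  Kummer.fnAct N X.O X.HA (X.outer g) (X.outer_conj_mem_HA g) (X.outer_inv_conj_mem_HA g) X.qHA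
    (X.conjH g) (X.qHA_conjH g)

end Def22Context

/-! ### Discharge of `SaturationConjugationInvariant` -/

/-- **Definition 2.2 (ii)**, "[conditions which are unaffected by composition with conjugation by an
element of `G`]" (FrdII p. 17) — DISCHARGE of `PadicKummer.SaturationConjugationInvariant`: replacing
`outer` by `conj(outer g) ∘ outer` replaces `H_A` by its conjugate under `γ = outer g` and `H ↠ H_A`
by `γ (·) γ⁻¹`; condition (c) transports by `Kummer.isCohSaturated_iff_of_conj`, (a), (b) are
untouched. [cite: MochizukiFrdII2008, Def 2.2 (ii) p.17] -/
theorem saturationConjugationInvariant_holds (X : Def22Context) (N : ℕ) :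
    SaturationConjugationInvariant X N := by
  intro g
  -- the conjugated data, read in the ambient group `Aut_E(A_E)` of `X`
  let K' : Subgroup X.AutE := X.H.map ((MulAut.conj (X.outer g)).toMonoidHom.comp X.outer)
  let q' : X.H →ₜ* K' := (X.conjOuter g).qHA
  have hK : ∀ k ∈ X.HA, X.outer g * k * (X.outer g)⁻¹ ∈ K' := by
    rintro _ ⟨h, hh, rfl⟩
    exact ⟨h, hh, rfl⟩
  have hK' : ∀ k' ∈ K', (X.outer g)⁻¹ * k' * X.outer g ∈ X.HA := by
    rintro _ ⟨h, hh, rfl⟩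
    refine ⟨h, hh, ?_⟩
    show X.outer h = (X.outer g)⁻¹ * (X.outer g * X.outer h * (X.outer g)⁻¹) * X.outer g
    group
  have hq' : ∀ h, ((q' h : K') : X.AutE) = X.outer g * X.qHA h * (X.outer g)⁻¹ := fun h => rfl
  have key := Kummer.isCohSaturated_iff_of_conj N X.O X.HA K' (X.outer g) hK hK' X.qHA q' hq'
  constructor
  · rintro ⟨a, b, c⟩
    exact ⟨a, b, key.mp c⟩
  · rintro ⟨a, b, c⟩
    exact ⟨a, b, key.mpr c⟩

variable (X : Def22Context) (N : ℕ) in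
/-- `SaturationConjugationInvariant` — `_holds` alias of `saturationConjugationInvariant_holds` above under the
fact's exact name, stated under the prover's own binders as section variables (appended 2026-08-28, D-0026 bookkeeping: the proof term is the
existing theorem of this file; no statement, definition or attribute is edited; no new named fact; the
ledger's debt table listed the fact unproved). [cite: MochizukiFrdII2008, Def 2.2 (ii) p.17] -/
theorem SaturationConjugationInvariant_holds : SaturationConjugationInvariant X N :=
  saturationConjugationInvariant_holds X N

/-! ### Theorem 2.4 (i): compatibility with the `G_A/H_A`-actions -/

section Thm24

variable (X₁ X₂ : Def22Context) (N : ℕ)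

/-- **Theorem 2.4 (i)**, final clause (FrdII p. 20): the isomorphisms induced by `Ψ` are compatible
"with the various natural actions of `(G₁)_{A₁}/(H₁)_{A₁}`, `(G₂)_{A₂}/(H₂)_{A₂}`" — typed for the
comparison data `T` of `PadicKummerSetting.Thm24Data` and `g ∈ G₁ ↦ T.isoG g ∈ G₂` (the actions of
`(Gᵢ)_{Aᵢ}` come from `Gᵢ` through `Gᵢ ↠ (Gᵢ)_{Aᵢ}`): equivariance of `isoO` on `O^□(Aᵢ)`, of
`isoHA` under conjugation, of `isoH1` for the actions on `H¹((Hᵢ)_{Aᵢ}, μ_N(Aᵢ))` and of `isoFN`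
for the actions on `F_N(Aᵢ)`. SCHEMA over `Thm24Data` (closed instantiation: abc-iut-L1-t4's `p`-adic
Frobenioids Ex. 1.1 + abc-iut-L4-t4's LCFT pin). [cite: MochizukiFrdII2008, Thm 2.4 (i) p.20] -/
def Thm24iActionCompat (T : Thm24Data X₁ X₂ N) : Prop :=
  ∀ g : X₁.G,
    (∀ x : X₁.O, T.isoO (X₁.outer g • x) = X₂.outer (T.isoG g) • T.isoO x) ∧
    (∀ k : X₁.HA,
      ((T.isoHA ⟨X₁.outer g * k * (X₁.outer g)⁻¹, X₁.outer_conj_mem_HA g k k.2⟩ : X₂.HA) :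
          X₂.AutE) =
        X₂.outer (T.isoG g) * (T.isoHA k : X₂.AutE) * (X₂.outer (T.isoG g))⁻¹) ∧
    (∀ c, T.isoH1 ((X₁.h1ActG N g).hom c) = (X₂.h1ActG N (T.isoG g)).hom (T.isoH1 c)) ∧
    (∀ x, T.isoFN (X₁.fnActG N g x) = X₂.fnActG N (T.isoG g) (T.isoFN x))

/-- **Remark 2.4.1** (FrdII p. 22): "By allowing `N ∈ ℕ_{≥1}` to vary … one obtains a profinite version
of Theorem 2.4, (i), so long as one allows for a `(Gᵢ)_{Aᵢ}/(Hᵢ)_{Aᵢ}`-indeterminacy in the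
resulting profinite Kummer and reciprocity maps" (because `(Hᵢ)_{Aᵢ}` acts trivially on
`H¹((Hᵢ)_{Aᵢ}, μ_N(Aᵢ))`, `F_N(Aᵢ)`). Finite-level content, SCHEMA: comparison data at two levels
`N`, `N'` differ by the action of an element of `G₂` (i.e. of `(G₂)_{A₂}/(H₂)_{A₂}`) on `O^□(A₂)` and
on `(H₂)_{A₂}`. The profinite LIMIT over `N` with varying `Aᵢ` ("one must exercise care with respect
to the coefficients `μ_N(Aᵢ)`", p. 22) is NOT constructed in the tree yet (named deferral).
[cite: MochizukiFrdII2008, Rmk 2.4.1 p.22] -/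
def Rmk241Indeterminacy {N N' : ℕ} (T : Thm24Data X₁ X₂ N) (T' : Thm24Data X₁ X₂ N') : Prop :=
  ∃ g : X₂.G, (∀ x : X₁.O, T'.isoO x = X₂.outer g • T.isoO x) ∧
    ∀ k : X₁.HA, (T'.isoHA k : X₂.AutE) = X₂.outer g * (T.isoHA k : X₂.AutE) * (X₂.outer g)⁻¹

end Thm24

end PadicKummer

end Literature.AlgebraicGeometry.Frobenioids
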